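import Literature.MathematicalPhysics.QuantumFieldTheory.Balaban1983to89.B9RWSumsAllBlocksPairM
import Literature.MathematicalPhysics.QuantumFieldTheory.Balaban1983to89.B9RWSumsCompleteGeo9YNbr
import Literature.MathematicalPhysics.QuantumFieldTheory.Balaban1983to89.B9RWSumsCompleteGeo9Y

/-!
# `Balaban1983to89.B9RWSumsCompleteGeo9YPair` — rows 13 ∕ 18 ∕ 19 of the N06 census AT THE GEOMETRY OF RECORD, neighbourhood-sited
# co-readings AND the printed second-order L² members (3.46)₃,₅ as DIRECTION-PAIR FAMILIES: Theorem 3.7 ∧ Corollary 3.8 and Theorem 3.10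
# at the literal all-blocks pins, composed from the operator-level inputs alone (the `Pair` twins of `B9RWSumsCompleteGeo9YNbr`)

T. Bałaban, *Propagators for lattice gauge theories in a background field*, Commun. Math. Phys. **99** (1985) 389–434
[`Balaban1985BackgroundPropagators`, "B9"], Thm 3.7 (3.90) p. 409, Cor. 3.8 (3.94) p. 410, Thm 3.10 (3.107)–(3.108) pp. 415–416,
(3.42)–(3.47) pp. 397–398 (p. 397: Δ̃(y)); [4] = T. Bałaban, *Propagators and renormalization transformations for lattice gauge
theories. II*, Commun. Math. Phys. **96** (1984) 223–250 [`Balaban1984PropagatorsII`], Lemma 2.1 (2.59)–(2.61) pp. 233–234, (2.2) p. 224,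
(2.51)–(2.52) p. 232.

statement-level skeleton of published theorems with citation tags; proofs where landed; nothing here is a claim about the
Yang–Mills mass gap

WHY THIS FILE.  `B9RWSumsCompleteGeo9YRel.thm37_cor38_complete_geo9Y_rel` ∕ `thm310_complete_geo9Y_rel` compose the all-blocks `Rel` leaves at
def-Y's members `geo9Y` — but their (3.43)–(3.46) co-reading binders `L2ReadsRel` ∕ `H1ReadsRel` ∕ `InputReadsRel` observe the class of y while
`(geo9Y x).cutIn = cutInT` is the Δ̃-reading, and n06-d's coordinate evaluation over-counts the fibre-L² size (`B9RWSumsReadsRelNegative`).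
Here (v4, `…PairM`) the SAME compositions on `B9RWSumsAllBlocksPairM.thm37Printed_allPin_completePairM` ∕ `thm310Printed_allPin_completePairM`
(ALL two-direction members on direction-pair families: the L² lines n = 4, 5 on ∇_ν∇_μG, G∇*_ν∇*_μ, the mixed L² line n = 3 AND the
(3.44)∕(3.45) members on ∇_νG∇*_μ — `B9RWSums346MixedPair`, `B9RWSums344InputPair`, schema `InputReadsFam` with sliced X-probes; X-lattice
input letter `bHX`; letters `DirOps37`∕`DirOps310`) at observation
radius `r := 2` with EVERY new geometric binder of the neighbourhood engines DISCHARGED BY NAME at the record: the triangle inequality and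
symmetry of d (`geo9Y_dist_triangle`, `geo9Y_dist_symm`), and the level comparability `d(a,a′) ≤ 2 ⇒ Lʲ⁽ᵃ⁾η ≤ L·Lʲ⁽ᵃ′⁾η` (§0, from the level
gap (2.60) in geometric form `levelGap_geo9K_one` and `M = L·M_h ≥ 8`).  What remains displayed about the readings: one block equivalence
`Rel x` per member with class multiplicity ≦ m and saturation, the neighbourhood count `(nbr (geo9Y x) 2 y).card ≤ mN`, the evaluation
constant `Cev ≥ 0`, and the sign `0 ≤ δ₁` of the all-blocks rate; the multiplicities enter the relations of the all-blocks constants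
(mN·m·Cev·L²·e^{2δ₁}·C·L ≦ B₁, …, m·L·e^{2δ₁}·holderConst(β) ≦ Bβ(β), e^{2δ₁}·inputConst44 ≦ Bε, L·e^{2δ₁}·inputConst45 ≦ Bεβ).

* (§0 of `B9RWSumsCompleteGeo9YNbr` by name: `len_le_of_dist_le_two_geo9Y`, `one_le_L_nat`.)
* ★★ `thm37_cor38_complete_geo9Y_pairM` — rows 13 ∕ 19 (G′ side): `B9.Thm37Printed ∧ B9.Cor38Printed` at the literal all-blocks datum.
* ★★ `thm310_complete_geo9Y_pairM` — rows 18 ∕ 19 (G side): `B9.Thm310Printed` at the literal all-blocks pin.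

HONEST SCOPE.  Kernel bookkeeping (two compositions and one geometric lemma); nothing of [B9] or [4] asserted; every remaining hypothesis is
operator-level (posited schemas of printed shape), a co-reading schema, a letter, a count, or a sign ∕ relation of constants.  NOT a node
discharge; count-neutral; one finite 𝕋^{d+1} programme at fixed ε — nothing continuum, nothing about the mass gap.  Cell `pub-ymgap` (HUMAN
RULING D-0062), Track A node N06 [B9], N06-ASSIGNMENT v1 bundle F6 (rows 18–19), seat `pub-ymgap-dag-n06-k` (gen 8), 2026-08-27 (v4 of the faces).
-/
namespace Literature.MathematicalPhysics.QuantumFieldTheory.Balaban1983to89.B9RWSumsCompleteGeo9YPairM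

open Literature.MathematicalPhysics.QuantumFieldTheory.Balaban1983to89
open Finset B6RandomWalk B9Thm34Ext B9Thm37Whole B9Cor38Whole B9Thm310Whole B9RowSum261Faces B9RowSum261DefiniteFaces
open B9Ineq349Whole B9RWSums343to347Whole B9PinMembersKLevelV1 B9GeoLemma21KLevelV1 B9RWSums347DefiniteFaces
open B9Thm37GlueCor36 B9Thm37Glue B9RWSums346Schur B9RWSums343Holder B9RWSums343HolderGp B9RWSums346Lap B9RWSums344Input
open B9RWSums344InputGp B9RWSums346Two B9RWSums346TwoGp B11SectG B9CoRealizesRel B9RWSumsReadsRel B9RWSumsReadsNbr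
open B9RWSumsAllBlocksNbr B9Ineq349Whole B9RWSums346SecondDiff B9RWSums346SecondDiffGp
open B9RWSumsCompleteGeo9YNbr B9RWSums346MixedPair B9RWSums344InputFam B9RWSums344InputPair B9RWSumsAllBlocksPairM
open Literature.MathematicalPhysics.QuantumFieldTheory.Balaban1983to89.B9RWSumsCompleteGeo9Y (const37_nonneg_of_signs)

noncomputable section

variable {d ℓ : ℕ} {hd : 1 ≤ d + 1} {hL : Odd (ℓ + 1) ∧ 1 < ℓ + 1} {b₀ b₁ : ℝ} {Mstar : ℕ}
variable [∀ x : MemberY d ℓ hd hL b₀ b₁ Mstar, Fintype (geo9Y x).Site]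
  [∀ x : MemberY d ℓ hd hL b₀ b₁ Mstar, DecidableEq (geo9Y x).Site]
variable {c35 : ℝ} {bg : MemberY d ℓ hd hL b₀ b₁ Mstar → B9.Backgrounds}


/-! ## Rows 13 ∕ 19, G′ side: Theorem 3.7 ∧ Corollary 3.8 at the literal all-blocks datum over the geometry of record -/

/-- ★★ **THEOREM 3.7 ∧ COROLLARY 3.8 AT THE LITERAL ALL-BLOCKS DATUM OVER def-Y's MEMBERS, FROM OPERATOR-LEVEL INPUTS ONLY, THE (3.43)–(3.46) CO-READINGS SITED ON THE NEIGHBOURHOOD OF RADIUS 2** (the `Nbr` form of `B9RWSumsCompleteGeo9YRel.thm37_cor38_complete_geo9Y_rel`, on `B9RWSumsAllBlocksNbr.thm37Printed_allPin_completeNbr`; the triangle inequality, symmetry and level comparability of `geo9Y` supplied by name; class multiplicity ≦ m, neighbourhood count ≦ mN and evaluation constant Cev folded into the constants' relations).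
With `C := const37 (exp261 geo9Y δ₀ α) δ₀ α ρ B₀ N N′ C_ℓ K_c`, `δ := (1 − 2α)δ₀` and the datum `E37AllOfOps (W38OfOps (𝔬 x) (rd x)
1 (H x) C δ) (𝔬 x) 1 (H x) C δ (K x) B₁ δ₁ Bβ Bε Bεβ` (p. 409 (3.90) with p. 410's *"convergent in all norms appearing in the
inequalities (3.42)–(3.47)"* READ as Theorem 3.1's typed blocks for the kernel family `K x`): the leaf `B9.Thm37Printed` AND the
leaf `B9.Cor38Printed` hold, given — the static data; Corollary 3.6's blocks for the G′_□ and the structure (3.88) (`h36`), the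
Hölder ∕ V-term ∕ Laplacian ∕ input ∕ two-sided L² legs (`h36H`) at (B₀, δ₀), all POSITED for M ≧ M₁, 0 < α₀,
O(1)Mα₀ ≦ a₁, (3.35); the co-readings of `K x`; the transpose letters; the support counts; the signs; and the relations of the
all-blocks constants (B₁, δ₁, Bβ, Bε, Bεβ) to the derived ones.  [4] Lemma 2.1 ((2.60), (2.61), the size condition), 1 ≦ L ≦ ℓ + 1,
η > 0 and d(a, b) = d(b, a) come from the record (`lemma21Pack_geo9Y`, `geo9Y_dist_symm`); the sup-block leaf from
`thm37_cor38_W38OfOps_exp261_geo9Y`; the rest is `B9RWSumsAllBlocksNbr.thm37Printed_allPin_completeNbr`.  Nothing of print asserted; NOT a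
node discharge. [cite: Balaban1985BackgroundPropagators, Thm 3.7 (3.90) pp.409–410 + Cor. 3.8 (3.94) p.410 + Cor. 3.6 p.408 + (3.42)–(3.47) pp.397–398; Balaban1984PropagatorsII, Lemma 2.1 (2.59)–(2.61) pp.233–234] -/
theorem thm37_cor38_complete_geo9Y_pairM {X Y ι PX PY Q : MemberY d ℓ hd hL b₀ b₁ Mstar → Type} [∀ x, Fintype (X x)]
    [∀ x, DecidableEq (X x)] [∀ x, Fintype (Y x)] [∀ x, DecidableEq (Y x)] [∀ x, Fintype (ι x)] [∀ x, Fintype (PX x)]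
    [∀ x, DecidableEq (PX x)] [∀ x, Fintype (PY x)] [∀ x, DecidableEq (PY x)] [∀ x, Fintype (Q x)]
    (𝔬 : ∀ x : MemberY d ℓ hd hL b₀ b₁ Mstar, Ops (geo9Y x) (bg x) (X x) (Y x) (ι x))
    (rd : ∀ x : MemberY d ℓ hd hL b₀ b₁ Mstar, WalkReading (geo9Y x) (bg x) (X x) (ι x))
    (H : MemberY d ℓ hd hL b₀ b₁ Mstar → Prop)
    (𝔭 : ∀ x : MemberY d ℓ hd hL b₀ b₁ Mstar, HolderProbes (geo9Y x) (bg x) (X x) (Y x) (PX x) (PY x))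
    (𝔡 : ∀ x : MemberY d ℓ hd hL b₀ b₁ Mstar, DirOps37 (𝔬 x) (Q x))
    (bHX : ∀ x : MemberY d ℓ hd hL b₀ b₁ Mstar, ℝ → BlockNorm (toB6 (geo9Y x) 1 (H x)) (X x → ℝ))
    (K : ∀ x : MemberY d ℓ hd hL b₀ b₁ Mstar, B9.KernelFamily (geo9Y x) (bg x))
    (ev : ∀ x : MemberY d ℓ hd hL b₀ b₁ Mstar, (geo9Y x).Loc → X x → ℝ)
    (evY : ∀ x : MemberY d ℓ hd hL b₀ b₁ Mstar, (geo9Y x).Loc → Y x → ℝ)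
    (Rel : ∀ x : MemberY d ℓ hd hL b₀ b₁ Mstar, (geo9Y x).Site → (geo9Y x).Site → Prop) [∀ x, DecidableRel (Rel x)] (m : ℕ)
    (Cev : ℝ) (mN : ℕ)
    (hRlen : ∀ x (a a' : (geo9Y x).Site), Rel x a a' → (geo9Y x).len a = (geo9Y x).len a')
    (hRd₁ : ∀ x (a a' b : (geo9Y x).Site), Rel x a a' → (geo9Y x).dist a b = (geo9Y x).dist a' b)
    (hRd₂ : ∀ x (a b b' : (geo9Y x).Site), Rel x b b' → (geo9Y x).dist a b = (geo9Y x).dist a b')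
    (hmult : ∀ x (y' : (geo9Y x).Site), (Finset.univ.filter (fun y'' => Rel x y'' y')).card ≤ m)
    (hnbr : ∀ (x : MemberY d ℓ hd hL b₀ b₁ Mstar) (y : (geo9Y x).Site), (nbr (geo9Y x) 2 y).card ≤ mN) (hCev : 0 ≤ Cev)
    (κ : MemberY d ℓ hd hL b₀ b₁ Mstar → Sizes) (SH S3 SI SM : ∀ x : MemberY d ℓ hd hL b₀ b₁ Mstar, ι x → Finset (geo9Y x).Site)
    (Bl BV BI θI : ℝ → ℝ) (BI2 : ℝ → ℝ → ℝ)
    (α ρ N N' Cℓ Kc θ₀ B₀ δ₀ a₁ M₁ αF NH N3 B3 θ3 NQ NI NM BM θM : ℝ) {B₁ δ₁ : ℝ} {Bβ Bε : ℝ → ℝ} {Bεβ : ℝ → ℝ → ℝ}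
    (hc : 0 < c35) (hα : 0 < α) (hα2 : α < 1 / 2) (hN : 0 ≤ N) (hN' : 0 ≤ N') (hCℓ : 1 ≤ Cℓ) (hK : 0 ≤ Kc) (hθ₀ : 0 ≤ θ₀)
    (hB₀ : 0 < B₀) (hδ₀ : 0 < δ₀) (ha₁ : 0 < a₁) (hM₁ : 0 < M₁) (hαF : 0 < αF) (hαF2 : αF ≤ 1 / 2) (hNH : 0 ≤ NH)
    (hN3 : 0 ≤ N3) (hB3 : 0 ≤ B3) (hθ3 : 0 ≤ θ3) (hNI : 0 ≤ NI) (hNM : 0 ≤ NM) (hBM : 0 ≤ BM) (hθM : 0 ≤ θM)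
    (hst : ∀ x, StaticOK (𝔬 x) ρ N N' Cℓ (κ x)) (hκ : ∀ x, (κ x).Bounded Kc θ₀ Cℓ (geo9Y x).M)
    (hrd : ∀ x, (rd x).OK (𝔬 x).blk) (hloc : ∀ x, Locality (𝔬 x) (rd x))
    (h36 : ∀ x, M₁ ≤ (geo9Y x).M → ∀ α₀ : ℝ, 0 < α₀ → c35 * (geo9Y x).M * α₀ ≤ a₁ →
      ∀ U : (bg x).Cfg, (bg x).Reg335 c35 α₀ U → Local342 (𝔬 x) 1 (H x) B₀ δ₀ U ∧ Identities (𝔬 x) 1 (H x) U)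
    (h36H : ∀ x, M₁ ≤ (geo9Y x).M → ∀ α₀ : ℝ, 0 < α₀ → c35 * (geo9Y x).M * α₀ ≤ a₁ →
      ∀ U : (bg x).Cfg, (bg x).Reg335 c35 α₀ U →
        HolderLegs37 (𝔬 x) (𝔭 x) 1 (H x) (SH x) Bl δ₀ U ∧ HolderV37 (𝔬 x) (𝔭 x) 1 (H x) BV δ₀ U ∧
          (L2SecondLegs37 (𝔬 x) (𝔡 x) 1 (H x) (S3 x) B3 δ₀ U ∧ FactorsL2Second37 (𝔬 x) (𝔡 x) 1 (H x) θ3 δ₀ U ∧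
            DirTranspose37 (𝔬 x) (𝔡 x) U) ∧
            (InputLegsPair37 (𝔬 x) (𝔡 x) (𝔭 x) 1 (H x) (bHX x) (SI x) BI BI2 δ₀ U ∧
              FactorsInputPair37 (𝔬 x) (𝔡 x) 1 (H x) (bHX x) θI δ₀ U ∧ DirSupHolder37 (𝔬 x) (𝔡 x) (𝔭 x) 1 (H x) U) ∧
              (L2MixedLegs37 (𝔬 x) (𝔡 x) 1 (H x) (SM x) BM δ₀ U ∧ FactorsL2Mixed37 (𝔬 x) (𝔡 x) 1 (H x) θM δ₀ U ∧
                DirSup37 (𝔬 x) (𝔡 x) 1 (H x) U))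
    (hco0 : ∀ x U, CoRealizesRel (K x) 0 U (Rel x) (𝔬 x).blk (𝔬 x).blk (ev x) ((𝔬 x).Gp U))
    (hco1 : ∀ x U, CoRealizesRel (K x) 1 U (Rel x) (𝔬 x).blkY (𝔬 x).blk (ev x) ((𝔬 x).D U ∘ₗ (𝔬 x).Gp U))
    (hco2 : ∀ x U, CoRealizesRel (K x) 2 U (Rel x) (𝔬 x).blk (𝔬 x).blkY (evY x) ((𝔬 x).Gp U ∘ₗ (𝔬 x).Dstar U))
    (hco3 : ∀ x U, CoRealizesRel (K x) 3 U (Rel x) (𝔬 x).blk (𝔬 x).blk (ev x) ((𝔬 x).Lap U ∘ₗ (𝔬 x).Gp U))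
    (hgl0 : ∀ x U, GlobReads (K x) 0 U (𝔬 x).blk (𝔬 x).blk (ev x) ((𝔬 x).Gp U))
    (hgl1 : ∀ x U, GlobReads (K x) 1 U (𝔬 x).blkY (𝔬 x).blk (ev x) ((𝔬 x).D U ∘ₗ (𝔬 x).Gp U))
    (hgl2 : ∀ x U, GlobReads (K x) 2 U (𝔬 x).blk (𝔬 x).blkY (evY x) ((𝔬 x).Gp U ∘ₗ (𝔬 x).Dstar U))
    (hgl3 : ∀ x U, GlobReads (K x) 3 U (𝔬 x).blk (𝔬 x).blk (ev x) ((𝔬 x).Lap U ∘ₗ (𝔬 x).Gp U))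
    (hl0 : ∀ x U, L2ReadsNbr (R := 1) (H := H x) (K x) 0 U (Rel x) 2 Cev (𝔬 x).blk (𝔬 x).blk (ev x) ((𝔬 x).Gp U))
    (hl1 : ∀ x U, L2ReadsNbr (R := 1) (H := H x) (K x) 1 U (Rel x) 2 Cev (𝔬 x).blkY (𝔬 x).blk (ev x) ((𝔬 x).D U ∘ₗ (𝔬 x).Gp U))
    (hl2 : ∀ x U, L2ReadsNbr (R := 1) (H := H x) (K x) 2 U (Rel x) 2 Cev (𝔬 x).blk (𝔬 x).blkY (evY x) ((𝔬 x).Gp U ∘ₗ (𝔬 x).Dstar U))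
    (hl3 : ∀ x U, L2ReadsNbr (R := 1) (H := H x) (K x) 3 U (Rel x) 2 Cev ((𝔬 x).blk ∘ Prod.fst) (𝔬 x).blk (ev x)
      (familyOp fun p : Q x × Q x => (𝔡 x).Dd U p.1 ∘ₗ ((𝔬 x).Gp U ∘ₗ (𝔡 x).Dsd U p.2)))
    (hl4 : ∀ x U, L2ReadsNbr (R := 1) (H := H x) (K x) 4 U (Rel x) 2 Cev ((𝔬 x).blk ∘ Prod.fst) (𝔬 x).blk (ev x)
      (familyOp fun p : Q x × Q x => ((𝔡 x).Dd U p.1 ∘ₗ (𝔡 x).Dd U p.2) ∘ₗ (𝔬 x).Gp U))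
    (hl5 : ∀ x U, L2ReadsNbr (R := 1) (H := H x) (K x) 5 U (Rel x) 2 Cev ((𝔬 x).blk ∘ Prod.fst) (𝔬 x).blk (ev x)
      (familyOp fun p : Q x × Q x => (𝔬 x).Gp U ∘ₗ ((𝔡 x).Dsd U p.1 ∘ₗ (𝔡 x).Dsd U p.2)))
    (hH1 : ∀ x U, H1ReadsNbr (K x) U (𝔭 x) (Rel x) 2 (𝔬 x).blk (𝔬 x).blkY (ev x) (evY x) ((𝔬 x).D U ∘ₗ (𝔬 x).Gp U)
      ((𝔬 x).Gp U ∘ₗ (𝔬 x).Dstar U))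
    (hIR : ∀ x U, InputReadsFam (K x) U (bHX x) 2 ((𝔬 x).blk ∘ Prod.fst) ((𝔭 x).blkPX ∘ Prod.fst)
      (fun β => sliceProbe ((𝔭 x).ΦX U β)) (ev x)
      (familyOp fun p : Q x × Q x => (𝔡 x).Dd U p.1 ∘ₗ ((𝔬 x).Gp U ∘ₗ (𝔡 x).Dsd U p.2)))
    (hsym : ∀ x, M₁ ≤ (geo9Y x).M → ∀ α₀ : ℝ, 0 < α₀ → c35 * (geo9Y x).M * α₀ ≤ a₁ →
      ∀ U : (bg x).Cfg, (bg x).Reg335 c35 α₀ U → IsTransposePair ((𝔬 x).Gp U) ((𝔬 x).Gp U))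
    (htr : ∀ x, M₁ ≤ (geo9Y x).M → ∀ α₀ : ℝ, 0 < α₀ → c35 * (geo9Y x).M * α₀ ≤ a₁ →
      ∀ U : (bg x).Cfg, (bg x).Reg335 c35 α₀ U → IsTransposePair ((𝔬 x).D U ∘ₗ (𝔬 x).Gp U) ((𝔬 x).Gp U ∘ₗ (𝔬 x).Dstar U))
    (hcntH : ∀ x (a : (geo9Y x).Site), (∑ q, if a ∈ SH x q then (1 : ℝ) else 0) ≤ NH)
    (hcnt3 : ∀ x (a : (geo9Y x).Site), (∑ q, if a ∈ S3 x q then (1 : ℝ) else 0) ≤ N3)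
    (hNQ : ∀ x, (Fintype.card (Q x) : ℝ) ≤ NQ)
    (hcntI : ∀ x (a : (geo9Y x).Site), (∑ q, if a ∈ SI x q then (1 : ℝ) else 0) ≤ NI)
    (hcntM : ∀ x (a : (geo9Y x).Site), (∑ q, if a ∈ SM x q then (1 : ℝ) else 0) ≤ NM)
    (hBl : ∀ β, 0 ≤ β → β < 1 → 0 ≤ Bl β) (hBV : ∀ β, 0 ≤ β → β < 1 → 0 ≤ BV β)
    (hBI : ∀ ε, 0 < ε → ε ≤ 1 → 0 ≤ BI ε) (hBI2 : ∀ ε β, 0 < ε → ε ≤ 1 → 0 ≤ β → β < 1 → 0 ≤ BI2 ε β)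
    (hθI : ∀ ε, 0 < ε → 0 ≤ θI ε)
    -- the relations of the all-blocks constants (B₁, δ₁, Bβ, Bε, Bεβ) to the definite derived ones
    (hCB : (m : ℝ) * const37 (exp261 (@geo9Y d ℓ hd hL b₀ b₁ Mstar) δ₀ α) δ₀ α ρ B₀ N N' Cℓ Kc ≤ B₁)
    (hCL : (mN : ℝ) * m * Cev * (((ℓ + 1 : ℕ) : ℝ)) ^ 2 * Real.exp (2 * δ₁) * 
      (const37 (exp261 (@geo9Y d ℓ hd hL b₀ b₁ Mstar) δ₀ α) δ₀ α ρ B₀ N N' Cℓ Kc * ((ℓ + 1 : ℕ) : ℝ)) ≤ B₁)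
    (hδ₁nn : 0 ≤ δ₁) (hδ₁ : δ₁ ≤ (1 - 2 * αF) * ((1 - 2 * α) * δ₀))
    (hCg : const37 (exp261 (@geo9Y d ℓ hd hL b₀ b₁ Mstar) δ₀ α) δ₀ α ρ B₀ N N' Cℓ Kc *
      B6.c1 (exp261 (@geo9Y d ℓ hd hL b₀ b₁ Mstar) ((1 - 2 * α) * δ₀) (1 - αF)) ((1 - 2 * α) * δ₀) (1 - αF) *
        ((ℓ + 1 : ℕ) : ℝ) ^ (4 : ℝ) ≤ B₁)
    (hB35 : (mN : ℝ) * m * Cev * (((ℓ + 1 : ℕ) : ℝ)) ^ 2 * Real.exp (2 * δ₁) * 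
      (NQ * secondConst (exp261 (@geo9Y d ℓ hd hL b₀ b₁ Mstar) δ₀ α) δ₀ α N3 B3 N' θ3
        (const37 (exp261 (@geo9Y d ℓ hd hL b₀ b₁ Mstar) δ₀ α) δ₀ α ρ B₀ N N' Cℓ Kc) ((ℓ + 1 : ℕ) : ℝ)) ≤ B₁)
    (hB3M : (mN : ℝ) * m * Cev * (((ℓ + 1 : ℕ) : ℝ)) ^ 2 * Real.exp (2 * δ₁) *
      (NQ * mixedConst (exp261 (@geo9Y d ℓ hd hL b₀ b₁ Mstar) δ₀ α) δ₀ α NM BM N' θM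
        (const37 (exp261 (@geo9Y d ℓ hd hL b₀ b₁ Mstar) δ₀ α) δ₀ α ρ B₀ N N' Cℓ Kc) ((ℓ + 1 : ℕ) : ℝ)) ≤ B₁)
    (hBβ : ∀ β, 0 ≤ β → β < 1 →
      (m : ℝ) * ((ℓ + 1 : ℕ) : ℝ) * Real.exp (2 * δ₁) * holderConst (exp261 (@geo9Y d ℓ hd hL b₀ b₁ Mstar) δ₀ α) δ₀ α NH N'
        (const37 (exp261 (@geo9Y d ℓ hd hL b₀ b₁ Mstar) δ₀ α) δ₀ α ρ B₀ N N' Cℓ Kc) (Bl β) (BV β) ≤ Bβ β)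
    (hBε : ∀ ε, 0 < ε → ε ≤ 1 →
      Real.exp (2 * δ₁) * inputConst44 (exp261 (@geo9Y d ℓ hd hL b₀ b₁ Mstar) δ₀ α) δ₀ α NI N'
        (const37 (exp261 (@geo9Y d ℓ hd hL b₀ b₁ Mstar) δ₀ α) δ₀ α ρ B₀ N N' Cℓ Kc) ((ℓ + 1 : ℕ) : ℝ) (BI ε) (θI ε) ≤ Bε ε)
    (hBεβ : ∀ ε β, 0 < ε → ε ≤ 1 → 0 ≤ β → β < 1 →
      ((ℓ + 1 : ℕ) : ℝ) * Real.exp (2 * δ₁) * inputConst45 (exp261 (@geo9Y d ℓ hd hL b₀ b₁ Mstar) δ₀ α) δ₀ α NI N' ((ℓ + 1 : ℕ) : ℝ)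
        (holderConst (exp261 (@geo9Y d ℓ hd hL b₀ b₁ Mstar) δ₀ α) δ₀ α NH N'
          (const37 (exp261 (@geo9Y d ℓ hd hL b₀ b₁ Mstar) δ₀ α) δ₀ α ρ B₀ N N' Cℓ Kc) (Bl β) (BV β))
        (BI2 ε β) (θI (β + ε)) ≤ Bεβ ε β) :
    B9.Thm37Printed c35 geo9Y bg
        (fun x => E37AllOfOps
          (W38OfOps (𝔬 x) (rd x) 1 (H x) (const37 (exp261 (@geo9Y d ℓ hd hL b₀ b₁ Mstar) δ₀ α) δ₀ α ρ B₀ N N' Cℓ Kc)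
            ((1 - 2 * α) * δ₀))
          (𝔬 x) 1 (H x) (const37 (exp261 (@geo9Y d ℓ hd hL b₀ b₁ Mstar) δ₀ α) δ₀ α ρ B₀ N N' Cℓ Kc) ((1 - 2 * α) * δ₀)
          (K x) B₁ δ₁ Bβ Bε Bεβ) ∧
      B9.Cor38Printed c35 geo9Y bg
        (fun x => E37AllOfOps
          (W38OfOps (𝔬 x) (rd x) 1 (H x) (const37 (exp261 (@geo9Y d ℓ hd hL b₀ b₁ Mstar) δ₀ α) δ₀ α ρ B₀ N N' Cℓ Kc)
            ((1 - 2 * α) * δ₀))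
          (𝔬 x) 1 (H x) (const37 (exp261 (@geo9Y d ℓ hd hL b₀ b₁ Mstar) δ₀ α) δ₀ α ρ B₀ N N' Cℓ Kc) ((1 - 2 * α) * δ₀)
          (K x) B₁ δ₁ Bβ Bε Bεβ) := by
  obtain ⟨Mth, h261, hfacts, -⟩ :=
    lemma21Pack_geo9Y (d := d) (ℓ := ℓ) (hd := hd) (hL := hL) (b₀ := b₀) (b₁ := b₁) (Mstar := Mstar) H hα hα2 hδ₀ hαF
      (by linarith)
  obtain ⟨h37, hc38⟩ := thm37_cor38_W38OfOps_exp261_geo9Y (bg := bg) 𝔬 rd (fun _ => 1) H κ α ρ N N' Cℓ Kc θ₀ B₀ δ₀ a₁ M₁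
    hc hα hα2.le hN hN' hCℓ hK hθ₀ hB₀ hδ₀ ha₁ hM₁ hst hκ hrd hloc h36
  have hC : 0 ≤ const37 (exp261 (@geo9Y d ℓ hd hL b₀ b₁ Mstar) δ₀ α) δ₀ α ρ B₀ N N' Cℓ Kc :=
    const37_nonneg_of_signs _ hB₀.le hN hN' (zero_le_one.trans hCℓ) hK
  have hδs : 0 < (1 - 2 * α) * δ₀ := mul_pos (by linarith) hδ₀
  refine ⟨?_, (cor38Printed_E37AllOfOps_iff _ 𝔬 (fun _ => 1) H _ _ K B₁ δ₁ Bβ Bε Bεβ).mpr hc38⟩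
  exact thm37Printed_allPin_completePairM (geo := geo9Y) (R := fun _ => (1 : ℝ)) 𝔭 𝔡 bHX K ev evY Rel m 2 Cev (((ℓ + 1 : ℕ) : ℝ)) mN κ SH Bl BV
    (exp261 (@geo9Y d ℓ hd hL b₀ b₁ Mstar) δ₀ α) δ₀ α ρ N N' Cℓ Kc θ₀ B₀ NH a₁ M₁ Mth S3 N3 B3 θ3 NQ
    SI NI BI θI BI2 SM NM BM θM h37 hRlen hRd₁ hRd₂ hmult hnbr one_le_L_nat len_le_of_dist_le_two_geo9Y
    geo9Y_dist_triangle hCev hco0 hco1 hco2 hco3 hgl0 hgl1 hgl2 hgl3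
    hl0 hl1 hl2 hl3 hl4 hl5 hH1 hIR hsym htr hfacts geo9Y_dist_symm hC hCB hCL hδ₁nn (by nlinarith) hδ₁
    (mul_nonneg hαF.le hδs.le) (by nlinarith) hCg hc ha₁ hα.le hα2.le hN' hB₀.le hNH hM₁ hδs.le le_rfl
    hδ₀.le hN3 hB3 hθ3 hNI hNM hBM hθM hB35 hB3M hst hκ hcntH hcnt3 hNQ hcntI hcntM hBl hBV hBI hBI2 hθI hBβ hBε hBεβ h261
    (fun x hM α₀ hα₀ ha U hU => ⟨(h36 x hM α₀ hα₀ ha U hU).1, (h36 x hM α₀ hα₀ ha U hU).2, (h36H x hM α₀ hα₀ ha U hU).1,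
      (h36H x hM α₀ hα₀ ha U hU).2.1⟩)
    (fun x hM α₀ hα₀ ha U hU => (h36H x hM α₀ hα₀ ha U hU).2.2.1)
    (fun x hM α₀ hα₀ ha U hU => (h36H x hM α₀ hα₀ ha U hU).2.2.2.1)
    (fun x hM α₀ hα₀ ha U hU => (h36H x hM α₀ hα₀ ha U hU).2.2.2.2)

/-! ## Rows 18 ∕ 19, G side: Theorem 3.10 at the literal all-blocks pin over the geometry of record -/

/-- ★★ **THEOREM 3.10 AT THE LITERAL ALL-BLOCKS PIN OVER def-Y's MEMBERS, FROM OPERATOR-LEVEL INPUTS ONLY, THE (3.43)–(3.46) CO-READINGS SITED ON THE NEIGHBOURHOOD OF RADIUS 2** (the `Nbr` form of `B9RWSumsCompleteGeo9YRel.thm310_complete_geo9Y_rel`, on `B9RWSumsAllBlocksNbr.thm310Printed_allPin_completeNbr`; `geo9Y_dist_triangle`, `geo9Y_dist_symm`, `len_le_of_dist_le_two_geo9Y` by name).  With `C := const37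
(exp261 geo9Y δ₀ α) δ₀ α ρ B₀ N N′ C_ℓ K_c`, `δ := (1 − 2α)δ₀` and the pin `W310OfOps (𝔬 x) (rd x) (ConvAll3107 (𝔬 x) 1 (H x) C δ (K x)
B₁ δ₁ Bβ Bε Bεβ)` (p. 416: *"From (3.108) it follows that the expansion (3.107) is convergent in all norms in the inequalities
(3.42)–(3.47). This implies Theorem 3.3."* READ as Theorem 3.3's typed blocks for `K x`): the leaf `B9.Thm310Printed` holds, given
— the static data (`StaticOK310`, `Sizes310.Bounded`, `WalkReading310.OK`, `Locality310`); Corollary 3.6's blocks for the G_□, (3.89)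
and the structure (3.105) (`h36`), the Hölder ∕ probe-factor ∕ Laplacian ∕ input ∕ two-sided L² legs (`h36H`) at
(B₀, δ₀), all POSITED for M ≧ M₁, 0 < α₀, O(1)Mα₀ ≦ a₁, (3.35); the co-readings of `K x`; the transpose letters; the support
counts; the signs; the relations of (B₁, δ₁, Bβ, Bε, Bεβ) to the derived constants.  [4] Lemma 2.1, 1 ≦ L ≦ ℓ + 1, η > 0 and the
symmetry of d come from the record (`lemma21Pack_geo9Y`, `geo9Y_dist_symm`), the sup-block leaf from `thm310Printed_exp261_geo9Y`,
the rest is `B9RWSumsAllBlocksNbr.thm310Printed_allPin_completeNbr`.  Nothing of print asserted; NOT a node discharge.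
[cite: Balaban1985BackgroundPropagators, Thm 3.10 (3.105)–(3.108) pp.413–416 + Thm 3.3 p.399 + Cor. 3.6 p.408 + (3.42)–(3.47) pp.397–398; Balaban1984PropagatorsII, Lemma 2.1 (2.59)–(2.61) pp.233–234] -/
theorem thm310_complete_geo9Y_pairM {X Y ι A PX PY Q : MemberY d ℓ hd hL b₀ b₁ Mstar → Type} [∀ x, Fintype (X x)]
    [∀ x, DecidableEq (X x)] [∀ x, Fintype (Y x)] [∀ x, DecidableEq (Y x)] [∀ x, Fintype (ι x)] [∀ x, Fintype (A x)]
    [∀ x, Fintype (PX x)] [∀ x, DecidableEq (PX x)] [∀ x, Fintype (PY x)] [∀ x, DecidableEq (PY x)] [∀ x, Fintype (Q x)]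
    (𝔬 : ∀ x : MemberY d ℓ hd hL b₀ b₁ Mstar, Ops310 (geo9Y x) (bg x) (X x) (Y x) (ι x) (A x))
    (rd : ∀ x : MemberY d ℓ hd hL b₀ b₁ Mstar, WalkReading310 (geo9Y x) (bg x) (X x) (ι x) (A x))
    (H : MemberY d ℓ hd hL b₀ b₁ Mstar → Prop)
    (𝔭 : ∀ x : MemberY d ℓ hd hL b₀ b₁ Mstar, HolderProbes (geo9Y x) (bg x) (X x) (Y x) (PX x) (PY x))
    (𝔡 : ∀ x : MemberY d ℓ hd hL b₀ b₁ Mstar, DirOps310 (𝔬 x) (Q x))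
    (bHX : ∀ x : MemberY d ℓ hd hL b₀ b₁ Mstar, ℝ → BlockNorm (toB6 (geo9Y x) 1 (H x)) (X x → ℝ))
    (K : ∀ x : MemberY d ℓ hd hL b₀ b₁ Mstar, B9.KernelFamily (geo9Y x) (bg x))
    (ev : ∀ x : MemberY d ℓ hd hL b₀ b₁ Mstar, (geo9Y x).Loc → X x → ℝ)
    (evY : ∀ x : MemberY d ℓ hd hL b₀ b₁ Mstar, (geo9Y x).Loc → Y x → ℝ)
    (Rel : ∀ x : MemberY d ℓ hd hL b₀ b₁ Mstar, (geo9Y x).Site → (geo9Y x).Site → Prop) [∀ x, DecidableRel (Rel x)] (m : ℕ)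
    (Cev : ℝ) (mN : ℕ)
    (hRlen : ∀ x (a a' : (geo9Y x).Site), Rel x a a' → (geo9Y x).len a = (geo9Y x).len a')
    (hRd₁ : ∀ x (a a' b : (geo9Y x).Site), Rel x a a' → (geo9Y x).dist a b = (geo9Y x).dist a' b)
    (hRd₂ : ∀ x (a b b' : (geo9Y x).Site), Rel x b b' → (geo9Y x).dist a b = (geo9Y x).dist a b')
    (hmult : ∀ x (y' : (geo9Y x).Site), (Finset.univ.filter (fun y'' => Rel x y'' y')).card ≤ m)
    (hnbr : ∀ (x : MemberY d ℓ hd hL b₀ b₁ Mstar) (y : (geo9Y x).Site), (nbr (geo9Y x) 2 y).card ≤ mN) (hCev : 0 ≤ Cev)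
    (κ : MemberY d ℓ hd hL b₀ b₁ Mstar → Sizes310)
    (SH S3 SI SM : ∀ x : MemberY d ℓ hd hL b₀ b₁ Mstar, ι x → Finset (geo9Y x).Site)
    (Bl θH BI θI : ℝ → ℝ) (BI2 : ℝ → ℝ → ℝ)
    (α ρ N N' NF Cℓ Kc θ₀ B₀ δ₀ a₁ M₁ αF NH N3 B3 θ3 NQ NI NM BM θM : ℝ) {B₁ δ₁ : ℝ} {Bβ Bε : ℝ → ℝ} {Bεβ : ℝ → ℝ → ℝ}
    (hc : 0 < c35) (hα : 0 < α) (hα2 : α < 1 / 2) (hN : 0 ≤ N) (hN' : 0 ≤ N') (hNF : 0 ≤ NF) (hCℓ : 1 ≤ Cℓ) (hK : 0 ≤ Kc)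
    (hθ₀ : 0 ≤ θ₀) (hB₀ : 0 < B₀) (hδ₀ : 0 < δ₀) (ha₁ : 0 < a₁) (hM₁ : 0 < M₁) (hαF : 0 < αF) (hαF2 : αF ≤ 1 / 2)
    (hNH : 0 ≤ NH) (hN3 : 0 ≤ N3) (hB3 : 0 ≤ B3) (hθ3 : 0 ≤ θ3) (hNI : 0 ≤ NI) (hNM : 0 ≤ NM) (hBM : 0 ≤ BM) (hθM : 0 ≤ θM)
    (hst : ∀ x, StaticOK310 (𝔬 x) ρ N N' NF Cℓ (κ x)) (hκ : ∀ x, (κ x).Bounded Kc)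
    (hrd : ∀ x, (rd x).OK (𝔬 x).blk) (hloc : ∀ x, Locality310 (𝔬 x) (rd x))
    (h36 : ∀ x, M₁ ≤ (geo9Y x).M → ∀ α₀ : ℝ, 0 < α₀ → c35 * (geo9Y x).M * α₀ ≤ a₁ →
      ∀ U : (bg x).Cfg, (bg x).Reg335 c35 α₀ U →
        Local342G (𝔬 x) 1 (H x) B₀ δ₀ U ∧ B9Thm310Whole.Factors389 (𝔬 x) 1 (H x) θ₀ δ₀ U ∧ Identities310 (𝔬 x) 1 (H x) U)
    (h36H : ∀ x, M₁ ≤ (geo9Y x).M → ∀ α₀ : ℝ, 0 < α₀ → c35 * (geo9Y x).M * α₀ ≤ a₁ →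
      ∀ U : (bg x).Cfg, (bg x).Reg335 c35 α₀ U →
        HolderLegs310 (𝔬 x) (𝔭 x) 1 (H x) (SH x) Bl δ₀ U ∧ FactorsHolder310 (𝔬 x) (𝔭 x) 1 (H x) θH δ₀ U ∧
          (L2SecondLegs310 (𝔬 x) (𝔡 x) 1 (H x) (S3 x) B3 δ₀ U ∧ FactorsL2Second310 (𝔬 x) (𝔡 x) 1 (H x) θ3 δ₀ U ∧
            DirTranspose310 (𝔬 x) (𝔡 x) U) ∧
            (InputLegsPair310 (𝔬 x) (𝔡 x) (𝔭 x) 1 (H x) (bHX x) (SI x) BI BI2 δ₀ U ∧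
              FactorsInputPair310 (𝔬 x) (𝔡 x) 1 (H x) (bHX x) θI δ₀ U ∧ DirSupHolder310 (𝔬 x) (𝔡 x) (𝔭 x) 1 (H x) U) ∧
              (L2MixedLegs310 (𝔬 x) (𝔡 x) 1 (H x) (SM x) BM δ₀ U ∧ FactorsL2Mixed310 (𝔬 x) (𝔡 x) 1 (H x) θM δ₀ U ∧
                DirSup310 (𝔬 x) (𝔡 x) 1 (H x) U))
    (hco0 : ∀ x U, CoRealizesRel (K x) 0 U (Rel x) (𝔬 x).blk (𝔬 x).blk (ev x) ((𝔬 x).G U))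
    (hco1 : ∀ x U, CoRealizesRel (K x) 1 U (Rel x) (𝔬 x).blkY (𝔬 x).blk (ev x) ((𝔬 x).D U ∘ₗ (𝔬 x).G U))
    (hco2 : ∀ x U, CoRealizesRel (K x) 2 U (Rel x) (𝔬 x).blk (𝔬 x).blkY (evY x) ((𝔬 x).G U ∘ₗ (𝔬 x).Dstar U))
    (hco3 : ∀ x U, CoRealizesRel (K x) 3 U (Rel x) (𝔬 x).blk (𝔬 x).blk (ev x) ((𝔬 x).Lap U ∘ₗ (𝔬 x).G U))
    (hgl0 : ∀ x U, GlobReads (K x) 0 U (𝔬 x).blk (𝔬 x).blk (ev x) ((𝔬 x).G U))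
    (hgl1 : ∀ x U, GlobReads (K x) 1 U (𝔬 x).blkY (𝔬 x).blk (ev x) ((𝔬 x).D U ∘ₗ (𝔬 x).G U))
    (hgl2 : ∀ x U, GlobReads (K x) 2 U (𝔬 x).blk (𝔬 x).blkY (evY x) ((𝔬 x).G U ∘ₗ (𝔬 x).Dstar U))
    (hgl3 : ∀ x U, GlobReads (K x) 3 U (𝔬 x).blk (𝔬 x).blk (ev x) ((𝔬 x).Lap U ∘ₗ (𝔬 x).G U))
    (hl0 : ∀ x U, L2ReadsNbr (R := 1) (H := H x) (K x) 0 U (Rel x) 2 Cev (𝔬 x).blk (𝔬 x).blk (ev x) ((𝔬 x).G U))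
    (hl1 : ∀ x U, L2ReadsNbr (R := 1) (H := H x) (K x) 1 U (Rel x) 2 Cev (𝔬 x).blkY (𝔬 x).blk (ev x) ((𝔬 x).D U ∘ₗ (𝔬 x).G U))
    (hl2 : ∀ x U, L2ReadsNbr (R := 1) (H := H x) (K x) 2 U (Rel x) 2 Cev (𝔬 x).blk (𝔬 x).blkY (evY x) ((𝔬 x).G U ∘ₗ (𝔬 x).Dstar U))
    (hl3 : ∀ x U, L2ReadsNbr (R := 1) (H := H x) (K x) 3 U (Rel x) 2 Cev ((𝔬 x).blk ∘ Prod.fst) (𝔬 x).blk (ev x)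
      (familyOp fun p : Q x × Q x => (𝔡 x).Dd U p.1 ∘ₗ ((𝔬 x).G U ∘ₗ (𝔡 x).Dsd U p.2)))
    (hl4 : ∀ x U, L2ReadsNbr (R := 1) (H := H x) (K x) 4 U (Rel x) 2 Cev ((𝔬 x).blk ∘ Prod.fst) (𝔬 x).blk (ev x)
      (familyOp fun p : Q x × Q x => ((𝔡 x).Dd U p.1 ∘ₗ (𝔡 x).Dd U p.2) ∘ₗ (𝔬 x).G U))
    (hl5 : ∀ x U, L2ReadsNbr (R := 1) (H := H x) (K x) 5 U (Rel x) 2 Cev ((𝔬 x).blk ∘ Prod.fst) (𝔬 x).blk (ev x)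
      (familyOp fun p : Q x × Q x => (𝔬 x).G U ∘ₗ ((𝔡 x).Dsd U p.1 ∘ₗ (𝔡 x).Dsd U p.2)))
    (hH1 : ∀ x U, H1ReadsNbr (K x) U (𝔭 x) (Rel x) 2 (𝔬 x).blk (𝔬 x).blkY (ev x) (evY x) ((𝔬 x).D U ∘ₗ (𝔬 x).G U)
      ((𝔬 x).G U ∘ₗ (𝔬 x).Dstar U))
    (hIR : ∀ x U, InputReadsFam (K x) U (bHX x) 2 ((𝔬 x).blk ∘ Prod.fst) ((𝔭 x).blkPX ∘ Prod.fst)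
      (fun β => sliceProbe ((𝔭 x).ΦX U β)) (ev x)
      (familyOp fun p : Q x × Q x => (𝔡 x).Dd U p.1 ∘ₗ ((𝔬 x).G U ∘ₗ (𝔡 x).Dsd U p.2)))
    (hsym : ∀ x, M₁ ≤ (geo9Y x).M → ∀ α₀ : ℝ, 0 < α₀ → c35 * (geo9Y x).M * α₀ ≤ a₁ →
      ∀ U : (bg x).Cfg, (bg x).Reg335 c35 α₀ U → IsTransposePair ((𝔬 x).G U) ((𝔬 x).G U))
    (htr : ∀ x, M₁ ≤ (geo9Y x).M → ∀ α₀ : ℝ, 0 < α₀ → c35 * (geo9Y x).M * α₀ ≤ a₁ →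
      ∀ U : (bg x).Cfg, (bg x).Reg335 c35 α₀ U → IsTransposePair ((𝔬 x).D U ∘ₗ (𝔬 x).G U) ((𝔬 x).G U ∘ₗ (𝔬 x).Dstar U))
    (hcntH : ∀ x (a : (geo9Y x).Site), (∑ q, if a ∈ SH x q then (1 : ℝ) else 0) ≤ NH)
    (hcnt3 : ∀ x (a : (geo9Y x).Site), (∑ q, if a ∈ S3 x q then (1 : ℝ) else 0) ≤ N3)
    (hNQ : ∀ x, (Fintype.card (Q x) : ℝ) ≤ NQ)
    (hcntI : ∀ x (a : (geo9Y x).Site), (∑ q, if a ∈ SI x q then (1 : ℝ) else 0) ≤ NI)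
    (hcntM : ∀ x (a : (geo9Y x).Site), (∑ q, if a ∈ SM x q then (1 : ℝ) else 0) ≤ NM)
    (hBl : ∀ β, 0 ≤ β → β < 1 → 0 ≤ Bl β) (hθH : ∀ β, 0 ≤ β → β < 1 → 0 ≤ θH β)
    (hBI : ∀ ε, 0 < ε → ε ≤ 1 → 0 ≤ BI ε) (hBI2 : ∀ ε β, 0 < ε → ε ≤ 1 → 0 ≤ β → β < 1 → 0 ≤ BI2 ε β)
    (hθI : ∀ ε, 0 < ε → 0 ≤ θI ε)
    -- the relations of the all-blocks constants (B₁, δ₁, Bβ, Bε, Bεβ) to the definite derived ones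
    (hCB : (m : ℝ) * const37 (exp261 (@geo9Y d ℓ hd hL b₀ b₁ Mstar) δ₀ α) δ₀ α ρ B₀ N N' Cℓ Kc ≤ B₁)
    (hCL : (mN : ℝ) * m * Cev * (((ℓ + 1 : ℕ) : ℝ)) ^ 2 * Real.exp (2 * δ₁) * 
      (const37 (exp261 (@geo9Y d ℓ hd hL b₀ b₁ Mstar) δ₀ α) δ₀ α ρ B₀ N N' Cℓ Kc * ((ℓ + 1 : ℕ) : ℝ)) ≤ B₁)
    (hδ₁nn : 0 ≤ δ₁) (hδ₁ : δ₁ ≤ (1 - 2 * αF) * ((1 - 2 * α) * δ₀))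
    (hCg : const37 (exp261 (@geo9Y d ℓ hd hL b₀ b₁ Mstar) δ₀ α) δ₀ α ρ B₀ N N' Cℓ Kc *
      B6.c1 (exp261 (@geo9Y d ℓ hd hL b₀ b₁ Mstar) ((1 - 2 * α) * δ₀) (1 - αF)) ((1 - 2 * α) * δ₀) (1 - αF) *
        ((ℓ + 1 : ℕ) : ℝ) ^ (4 : ℝ) ≤ B₁)
    (hB35 : (mN : ℝ) * m * Cev * (((ℓ + 1 : ℕ) : ℝ)) ^ 2 * Real.exp (2 * δ₁) * 
      (NQ * secondConst (exp261 (@geo9Y d ℓ hd hL b₀ b₁ Mstar) δ₀ α) δ₀ α N3 B3 NF θ3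
        (const37 (exp261 (@geo9Y d ℓ hd hL b₀ b₁ Mstar) δ₀ α) δ₀ α ρ B₀ N N' Cℓ Kc) ((ℓ + 1 : ℕ) : ℝ)) ≤ B₁)
    (hB3M : (mN : ℝ) * m * Cev * (((ℓ + 1 : ℕ) : ℝ)) ^ 2 * Real.exp (2 * δ₁) *
      (NQ * mixedConst (exp261 (@geo9Y d ℓ hd hL b₀ b₁ Mstar) δ₀ α) δ₀ α NM BM NF θM
        (const37 (exp261 (@geo9Y d ℓ hd hL b₀ b₁ Mstar) δ₀ α) δ₀ α ρ B₀ N N' Cℓ Kc) ((ℓ + 1 : ℕ) : ℝ)) ≤ B₁)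
    (hBβ : ∀ β, 0 ≤ β → β < 1 →
      (m : ℝ) * ((ℓ + 1 : ℕ) : ℝ) * Real.exp (2 * δ₁) * holderConst (exp261 (@geo9Y d ℓ hd hL b₀ b₁ Mstar) δ₀ α) δ₀ α NH NF
        (const37 (exp261 (@geo9Y d ℓ hd hL b₀ b₁ Mstar) δ₀ α) δ₀ α ρ B₀ N N' Cℓ Kc) (Bl β) (θH β) ≤ Bβ β)
    (hBε : ∀ ε, 0 < ε → ε ≤ 1 →
      Real.exp (2 * δ₁) * inputConst44 (exp261 (@geo9Y d ℓ hd hL b₀ b₁ Mstar) δ₀ α) δ₀ α NI NF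
        (const37 (exp261 (@geo9Y d ℓ hd hL b₀ b₁ Mstar) δ₀ α) δ₀ α ρ B₀ N N' Cℓ Kc) ((ℓ + 1 : ℕ) : ℝ) (BI ε) (θI ε) ≤ Bε ε)
    (hBεβ : ∀ ε β, 0 < ε → ε ≤ 1 → 0 ≤ β → β < 1 →
      ((ℓ + 1 : ℕ) : ℝ) * Real.exp (2 * δ₁) * inputConst45 (exp261 (@geo9Y d ℓ hd hL b₀ b₁ Mstar) δ₀ α) δ₀ α NI NF ((ℓ + 1 : ℕ) : ℝ)
        (holderConst (exp261 (@geo9Y d ℓ hd hL b₀ b₁ Mstar) δ₀ α) δ₀ α NH NF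
          (const37 (exp261 (@geo9Y d ℓ hd hL b₀ b₁ Mstar) δ₀ α) δ₀ α ρ B₀ N N' Cℓ Kc) (Bl β) (θH β))
        (BI2 ε β) (θI (β + ε)) ≤ Bεβ ε β) :
    B9.Thm310Printed c35 geo9Y bg
      (fun x => W310OfOps (𝔬 x) (rd x)
        (ConvAll3107 (𝔬 x) 1 (H x) (const37 (exp261 (@geo9Y d ℓ hd hL b₀ b₁ Mstar) δ₀ α) δ₀ α ρ B₀ N N' Cℓ Kc)
          ((1 - 2 * α) * δ₀) (K x) B₁ δ₁ Bβ Bε Bεβ)) := by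
  obtain ⟨Mth, h261, hfacts, -⟩ :=
    lemma21Pack_geo9Y (d := d) (ℓ := ℓ) (hd := hd) (hL := hL) (b₀ := b₀) (b₁ := b₁) (Mstar := Mstar) H hα hα2 hδ₀ hαF
      (by linarith)
  have h310 := thm310Printed_exp261_geo9Y (bg := bg) 𝔬 rd (fun _ => 1) H κ α ρ N N' NF Cℓ Kc θ₀ B₀ δ₀ a₁ M₁ hc hα hα2.le hN
    hN' hNF hCℓ hK hθ₀ hB₀ hδ₀ ha₁ hM₁ hst hκ hrd hloc h36
  have hC : 0 ≤ const37 (exp261 (@geo9Y d ℓ hd hL b₀ b₁ Mstar) δ₀ α) δ₀ α ρ B₀ N N' Cℓ Kc :=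
    const37_nonneg_of_signs _ hB₀.le hN hN' (zero_le_one.trans hCℓ) hK
  have hδs : 0 < (1 - 2 * α) * δ₀ := mul_pos (by linarith) hδ₀
  exact thm310Printed_allPin_completePairM (geo := geo9Y) (R := fun _ => (1 : ℝ)) 𝔭 𝔡 bHX K ev evY Rel m 2 Cev (((ℓ + 1 : ℕ) : ℝ)) mN κ SH Bl θH
    (exp261 (@geo9Y d ℓ hd hL b₀ b₁ Mstar) δ₀ α) δ₀ α ρ N N' NF Cℓ θ₀ NH a₁ M₁ Mth S3 N3 B3 θ3 NQ
    SI NI BI θI BI2 SM NM BM θM h310 hRlen hRd₁ hRd₂ hmult hnbr one_le_L_nat len_le_of_dist_le_two_geo9Y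
    geo9Y_dist_triangle hCev hco0 hco1 hco2 hco3 hgl0 hgl1 hgl2 hgl3
    hl0 hl1 hl2 hl3 hl4 hl5 hH1 hIR hsym htr hfacts geo9Y_dist_symm hC hCB hCL hδ₁nn (by nlinarith) hδ₁
    (mul_nonneg hαF.le hδs.le) (by nlinarith) hCg hc ha₁ hα.le hα2.le hNF hθ₀ hNH hδs.le le_rfl hδ₀.le hN3 hB3 hθ3 hNI hNM hBM
    hθM hB35 hB3M hst hcntH hcnt3 hNQ hcntI hcntM hBl hθH hBI hBI2 hθI hBβ hBε hBεβ h261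
    (fun x hM α₀ hα₀ ha U hU => ⟨(h36 x hM α₀ hα₀ ha U hU).2.1, (h36 x hM α₀ hα₀ ha U hU).2.2, (h36H x hM α₀ hα₀ ha U hU).1,
      (h36H x hM α₀ hα₀ ha U hU).2.1⟩)
    (fun x hM α₀ hα₀ ha U hU => (h36H x hM α₀ hα₀ ha U hU).2.2.1)
    (fun x hM α₀ hα₀ ha U hU => (h36H x hM α₀ hα₀ ha U hU).2.2.2.1)
    (fun x hM α₀ hα₀ ha U hU => (h36H x hM α₀ hα₀ ha U hU).2.2.2.2)

end

end Literature.MathematicalPhysics.QuantumFieldTheory.Balaban1983to89.B9RWSumsCompleteGeo9YPairM
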